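import Mathlib
import Summits.ResolutionOfSingularities.ResolutionOfSingularities.Theorems.WildQuotientsWildQuotientResolutionJordanFiveTwistedChartDefs
import Summits.ResolutionOfSingularities.ResolutionOfSingularities.Theorems.WildQuotientsWildQuotientResolutionToricExitWeightZero

/-!
# R-T rung (J₅) — T5-ii: the universal twisted chart lands in the `μ₃`-invariants (the `ℤ/3`-weight-`0` part)

(crux stmt-ResolutionOfSingularities-15640 `WildQuotients.WildQuotientResolution`, line `Sketch`,
sector `|G| = p`; programme «R-T twisted root charts in general» of `L/w45c/CHAIN.md` v7.9 §5,
design memo `L/res-L1-w45c-idea-2/RT-J5.md` §4 («`μ₃`-characters `(l, A, ξ, η₁, η₂) =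
(1, 2, 1, 2, 0)`»; deck-invariance of the five chart images re-derived in kit j275294).
[OURS · L1 W4.5c] — NOT a statement of any manuscript (Hironaka 2017 is consumed nowhere); replaces
the role of no printed item. Prover res-L1-w45c-stub-1. AI-written Lean, kernel-checked; weaker than
expert review.)

The twisted cube root `l` (`l³ = T'/H'`) makes the chart ring `k[l, A, ξ, η₁, η₂, passengers]` a
`μ₃`-cover of the `x_b`-vertex chart of `Bl_w 𝔸ⁿ`, `w = (4,3,2,1,0)`; the deck group `μ₃` acts with
characters `l ↦ 1`, `A ↦ 2`, `ξ ↦ 1`, `η₁ ↦ 2`, `η₂ ↦ 0` (passengers `↦ 0`). Since a primitive cube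
root of unity need not lie in `k`, the deck action is recorded — exactly as the parity grading of the
J₄ `μ₂`-vertex (`…JordanFourParity`) and the `ℤ/3`-weight of V4U piece 0 (`Third112.coneWeight`) — by
a WEIGHT `w : Fin n → ZMod 3` with `w b = 1`, `w a = 2`, `w c = 1`, `w d = 2` and `w i = 0` otherwise,
and T5-ii says: **every element of the image of `ψ₅ = JordanFive.twistedChart` is `w`-homogeneous of
weight `0`** (`isWeightedHomogeneous_twistedChart`), i.e. lies in the subalgebra generated by the
weight-`0` monomials (`twistedChart_mem_adjoin_monomial`, via
`ToricExit.mem_adjoin_monomial_of_isWeightedHomogeneous_zero`) — the `⅓(1,2,1,2) × 𝔸`-type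
Veronese subring that is the candidate normalisation of the vertex chart ring (the T2-analogue's
input). No hypothesis on the characteristic is needed here (the constants `C 2⁻¹, C 6⁻¹, C 24⁻¹` have
weight `0` whatever their value). Building blocks: `isWeightedHomogeneous_twistedP` (weight `1`),
`isWeightedHomogeneous_twistedD` (weight `2`), `isWeightedHomogeneous_twistedE` and
`isWeightedHomogeneous_twistedQ` (weight `0`).
-/

-- single-problem summit: the doubled namespace component `ResolutionOfSingularities` is forced
set_option linter.dupNamespace false

noncomputable section

open MvPolynomial

namespace Summit.ResolutionOfSingularities.ResolutionOfSingularities.Theorems.WildQuotientResolution.JordanFive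

section DeckWeight

variable (k : Type) [Field k] (n : ℕ) (a b c d e : Fin n)
  (w : Fin n → ZMod 3) (hwa : w a = 2) (hwb : w b = 1) (hwc : w c = 1) (hwd : w d = 2)
  (hwe : w e = 0)

/-- Re-labelling the weight of a weighted-homogeneous polynomial along an equality of weights.
[folklore] -/
theorem isWeightedHomogeneous_of_eq {m m' : ZMod 3} {φ : MvPolynomial (Fin n) k}
    (h : IsWeightedHomogeneous w φ m) (hm : m = m') : IsWeightedHomogeneous w φ m' := hm ▸ h

/-- Weighted-homogeneous polynomials of one weight are closed under subtraction. [folklore] -/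
theorem isWeightedHomogeneous_sub {m : ZMod 3} {φ ψ : MvPolynomial (Fin n) k}
    (hφ : IsWeightedHomogeneous w φ m) (hψ : IsWeightedHomogeneous w ψ m) :
    IsWeightedHomogeneous w (φ - ψ) m :=
  (weightedHomogeneousSubmodule k w m).sub_mem hφ hψ

/-- Weighted-homogeneous polynomials of one weight are closed under negation. [folklore] -/
theorem isWeightedHomogeneous_neg {m : ZMod 3} {φ : MvPolynomial (Fin n) k}
    (hφ : IsWeightedHomogeneous w φ m) : IsWeightedHomogeneous w (-φ) m :=
  (weightedHomogeneousSubmodule k w m).neg_mem hφ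

/-- Numerals have weight `0`. [folklore] -/
theorem isWeightedHomogeneous_ofNat (m : ℕ) [m.AtLeastTwo] :
    IsWeightedHomogeneous w (OfNat.ofNat m : MvPolynomial (Fin n) k) 0 := by
  rw [← map_ofNat C m]
  exact isWeightedHomogeneous_C w _

/-- A numeral multiple keeps the weight. [folklore] -/
theorem isWeightedHomogeneous_ofNat_mul (m : ℕ) [m.AtLeastTwo] {q : ZMod 3}
    {φ : MvPolynomial (Fin n) k} (hφ : IsWeightedHomogeneous w φ q) :
    IsWeightedHomogeneous w (OfNat.ofNat m * φ) q := by
  have h := (isWeightedHomogeneous_ofNat k n w m).mul hφ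
  rwa [zero_add] at h

include hwa hwb hwc hwd in
/-- `P = ξ + l + (A/2)(ξ² − lξ − η₁)` has weight `1`. [OURS · L1 W4.5c] -/
theorem isWeightedHomogeneous_twistedP :
    IsWeightedHomogeneous w (JordanFour.twistedP k n a b c d) 1 := by
  have ha := isWeightedHomogeneous_X k w a
  have hb := isWeightedHomogeneous_X k w b
  have hc := isWeightedHomogeneous_X k w c
  have hd := isWeightedHomogeneous_X k w d
  rw [hwa] at ha; rw [hwb] at hb; rw [hwc] at hc; rw [hwd] at hd
  -- `ξ² − lξ − η₁` has weight `2`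
  have h2 : IsWeightedHomogeneous w (X c ^ 2 - X b * X c - X d : MvPolynomial (Fin n) k) 2 :=
    isWeightedHomogeneous_sub k n w
      (isWeightedHomogeneous_sub k n w (isWeightedHomogeneous_of_eq k n w (hc.pow 2) (by decide))
        (isWeightedHomogeneous_of_eq k n w (hb.mul hc) (by decide))) hd
  -- `C 2⁻¹ * X a * (…)` has weight `0 + 2 + 2 = 1`
  have h3 : IsWeightedHomogeneous w
      (C (2⁻¹ : k) * X a * (X c ^ 2 - X b * X c - X d) : MvPolynomial (Fin n) k) 1 :=
    isWeightedHomogeneous_of_eq k n w (((isWeightedHomogeneous_C w (2⁻¹ : k)).mul ha).mul h2)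
      (by decide)
  unfold JordanFour.twistedP
  exact (hc.add hb).add h3

include hwa hwb hwc hwd in
/-- `D = twistedD` has weight `2`. [OURS · L1 W4.5c] -/
theorem isWeightedHomogeneous_twistedD :
    IsWeightedHomogeneous w (twistedD k n a b c d) 2 := by
  have ha := isWeightedHomogeneous_X k w a
  have hb := isWeightedHomogeneous_X k w b
  have hc := isWeightedHomogeneous_X k w c
  have hd := isWeightedHomogeneous_X k w d
  rw [hwa] at ha; rw [hwb] at hb; rw [hwc] at hc; rw [hwd] at hd
  have t1 : IsWeightedHomogeneous w (3 * X c ^ 2 : MvPolynomial (Fin n) k) 2 :=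
    isWeightedHomogeneous_ofNat_mul k n w 3 (isWeightedHomogeneous_of_eq k n w (hc.pow 2) (by decide))
  have t2 : IsWeightedHomogeneous w (3 * (X b * X c) : MvPolynomial (Fin n) k) 2 :=
    isWeightedHomogeneous_ofNat_mul k n w 3 (isWeightedHomogeneous_of_eq k n w (hb.mul hc) (by decide))
  have t4 : IsWeightedHomogeneous w (2 * X b ^ 2 : MvPolynomial (Fin n) k) 2 :=
    isWeightedHomogeneous_ofNat_mul k n w 2 (isWeightedHomogeneous_of_eq k n w (hb.pow 2) (by decide))
  have i1 : IsWeightedHomogeneous w (X c ^ 3 : MvPolynomial (Fin n) k) 0 :=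
    isWeightedHomogeneous_of_eq k n w (hc.pow 3) (by decide)
  have i2 : IsWeightedHomogeneous w (3 * (X b * X c ^ 2) : MvPolynomial (Fin n) k) 0 :=
    isWeightedHomogeneous_ofNat_mul k n w 3
      (isWeightedHomogeneous_of_eq k n w (hb.mul (hc.pow 2)) (by decide))
  have i3 : IsWeightedHomogeneous w (3 * (X c * X d) : MvPolynomial (Fin n) k) 0 :=
    isWeightedHomogeneous_ofNat_mul k n w 3 (isWeightedHomogeneous_of_eq k n w (hc.mul hd) (by decide))
  have i4 : IsWeightedHomogeneous w (2 * (X b ^ 2 * X c) : MvPolynomial (Fin n) k) 0 :=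
    isWeightedHomogeneous_ofNat_mul k n w 2
      (isWeightedHomogeneous_of_eq k n w ((hb.pow 2).mul hc) (by decide))
  have t5 : IsWeightedHomogeneous w
      (X a * (X c ^ 3 - 3 * (X b * X c ^ 2) - 3 * (X c * X d) + 2 * (X b ^ 2 * X c)) :
        MvPolynomial (Fin n) k) 2 :=
    isWeightedHomogeneous_of_eq k n w
      (ha.mul (((isWeightedHomogeneous_sub k n w (isWeightedHomogeneous_sub k n w i1 i2) i3).add i4)))
      (by decide)
  unfold twistedD
  exact (((t1.add t2) |> fun h => isWeightedHomogeneous_sub k n w h hd).add t4).add t5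

include hwa hwb hwc hwd hwe in
/-- `E = twistedE` has weight `0`. [OURS · L1 W4.5c] -/
theorem isWeightedHomogeneous_twistedE :
    IsWeightedHomogeneous w (twistedE k n a b c d e) 0 := by
  have ha := isWeightedHomogeneous_X k w a
  have hb := isWeightedHomogeneous_X k w b
  have hc := isWeightedHomogeneous_X k w c
  have hd := isWeightedHomogeneous_X k w d
  have he := isWeightedHomogeneous_X k w e
  rw [hwa] at ha; rw [hwb] at hb; rw [hwc] at hc; rw [hwd] at hd; rw [hwe] at he
  have t1 : IsWeightedHomogeneous w (4 * X c ^ 3 : MvPolynomial (Fin n) k) 0 :=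
    isWeightedHomogeneous_ofNat_mul k n w 4 (isWeightedHomogeneous_of_eq k n w (hc.pow 3) (by decide))
  have t2 : IsWeightedHomogeneous w (4 * (X b ^ 2 * X c) : MvPolynomial (Fin n) k) 0 :=
    isWeightedHomogeneous_ofNat_mul k n w 4
      (isWeightedHomogeneous_of_eq k n w ((hb.pow 2).mul hc) (by decide))
  have t3 : IsWeightedHomogeneous w (4 * (X d * X c) : MvPolynomial (Fin n) k) 0 :=
    isWeightedHomogeneous_ofNat_mul k n w 4 (isWeightedHomogeneous_of_eq k n w (hd.mul hc) (by decide))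
  have t4 : IsWeightedHomogeneous w (24 * X e : MvPolynomial (Fin n) k) 0 :=
    isWeightedHomogeneous_ofNat_mul k n w 24 he
  have i1 : IsWeightedHomogeneous w (X c ^ 4 : MvPolynomial (Fin n) k) 1 :=
    isWeightedHomogeneous_of_eq k n w (hc.pow 4) (by decide)
  have i2 : IsWeightedHomogeneous w (6 * (X b * X c ^ 3) : MvPolynomial (Fin n) k) 1 :=
    isWeightedHomogeneous_ofNat_mul k n w 6
      (isWeightedHomogeneous_of_eq k n w (hb.mul (hc.pow 3)) (by decide))
  have i3 : IsWeightedHomogeneous w (11 * (X b ^ 2 * X c ^ 2) : MvPolynomial (Fin n) k) 1 :=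
    isWeightedHomogeneous_ofNat_mul k n w 11
      (isWeightedHomogeneous_of_eq k n w ((hb.pow 2).mul (hc.pow 2)) (by decide))
  have i4 : IsWeightedHomogeneous w (6 * (X b ^ 3 * X c) : MvPolynomial (Fin n) k) 1 :=
    isWeightedHomogeneous_ofNat_mul k n w 6
      (isWeightedHomogeneous_of_eq k n w ((hb.pow 3).mul hc) (by decide))
  have i5 : IsWeightedHomogeneous w (6 * (X d * X c ^ 2) : MvPolynomial (Fin n) k) 1 :=
    isWeightedHomogeneous_ofNat_mul k n w 6
      (isWeightedHomogeneous_of_eq k n w (hd.mul (hc.pow 2)) (by decide))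
  have i6 : IsWeightedHomogeneous w (6 * (X b * X d * X c) : MvPolynomial (Fin n) k) 1 :=
    isWeightedHomogeneous_ofNat_mul k n w 6
      (isWeightedHomogeneous_of_eq k n w ((hb.mul hd).mul hc) (by decide))
  have t5 : IsWeightedHomogeneous w
      (X a * (X c ^ 4 - 6 * (X b * X c ^ 3) + 11 * (X b ^ 2 * X c ^ 2) - 6 * (X b ^ 3 * X c) -
        6 * (X d * X c ^ 2) + 6 * (X b * X d * X c)) : MvPolynomial (Fin n) k) 0 :=
    isWeightedHomogeneous_of_eq k n w
      (ha.mul ((isWeightedHomogeneous_sub k n w (isWeightedHomogeneous_sub k n w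
        ((isWeightedHomogeneous_sub k n w i1 i2).add i3) i4) i5).add i6)) (by decide)
  unfold twistedE
  exact (((isWeightedHomogeneous_sub k n w (t1.add t2) t3).add t4).add t5)

include hwa hwb hwd in
/-- `Q = 1 − 3lA + A²η₁` has weight `0`. [OURS · L1 W4.5c] -/
theorem isWeightedHomogeneous_twistedQ :
    IsWeightedHomogeneous w (JordanFour.twistedQ k n a b d) 0 := by
  have ha := isWeightedHomogeneous_X k w a
  have hb := isWeightedHomogeneous_X k w b
  have hd := isWeightedHomogeneous_X k w d
  rw [hwa] at ha; rw [hwb] at hb; rw [hwd] at hd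
  have t2 : IsWeightedHomogeneous w (3 * (X b * X a) : MvPolynomial (Fin n) k) 0 :=
    isWeightedHomogeneous_ofNat_mul k n w 3 (isWeightedHomogeneous_of_eq k n w (hb.mul ha) (by decide))
  have t3 : IsWeightedHomogeneous w (X a ^ 2 * X d : MvPolynomial (Fin n) k) 0 :=
    isWeightedHomogeneous_of_eq k n w ((ha.pow 2).mul hd) (by decide)
  unfold JordanFour.twistedQ
  exact (isWeightedHomogeneous_sub k n w (isWeightedHomogeneous_one k w) t2).add t3

variable (hw0 : ∀ i, i ≠ a → i ≠ b → i ≠ c → i ≠ d → w i = 0)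

include hwa hwb hwc hwd hw0 in
/-- **Every chart image `ψ₅(x_i)` has weight `0`.** [OURS · L1 W4.5c] -/
theorem isWeightedHomogeneous_twistedChart_X (hab : a ≠ b) (hac : a ≠ c) (had : a ≠ d)
    (hae : a ≠ e) (hbc : b ≠ c) (hbd : b ≠ d) (hbe : b ≠ e) (hcd : c ≠ d) (hce : c ≠ e) (hde : d ≠ e)
    (i : Fin n) : IsWeightedHomogeneous w (twistedChart k n a b c d e (X i)) 0 := by
  have ha := isWeightedHomogeneous_X k w a
  have hb := isWeightedHomogeneous_X k w b
  have hc := isWeightedHomogeneous_X k w c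
  rw [hwa] at ha; rw [hwb] at hb; rw [hwc] at hc
  have hwe : w e = 0 := hw0 e hae.symm hbe.symm hce.symm hde.symm
  by_cases hia : i = a
  · subst hia
    rw [twistedChart_X_a]
    exact isWeightedHomogeneous_of_eq k n w ((hb.pow 4).mul ha) (by decide)
  by_cases hib : i = b
  · subst hib
    rw [twistedChart_X_b k n a i c d e hab]
    exact isWeightedHomogeneous_of_eq k n w ((hb.pow 3).mul ((isWeightedHomogeneous_one k w).add
      (isWeightedHomogeneous_of_eq k n w (ha.mul hc) (by decide)))) (by decide)
  by_cases hic : i = c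
  · subst hic
    rw [twistedChart_X_c k n a b i d e hac hbc]
    exact isWeightedHomogeneous_of_eq k n w
      ((hb.pow 2).mul (isWeightedHomogeneous_twistedP k n a b i d w hwa hwb hwc hwd)) (by decide)
  by_cases hid : i = d
  · subst hid
    rw [twistedChart_X_d k n a b c i e had hbd hcd]
    exact (isWeightedHomogeneous_of_eq k n w
      (hb.mul (isWeightedHomogeneous_twistedD k n a b c i w hwa hwb hwc hwd)) (by decide)).C_mul _
  by_cases hie : i = e
  · subst hie
    rw [twistedChart_X_e k n a b c d i hae hbe hce hde]
    exact (isWeightedHomogeneous_twistedE k n a b c d i w hwa hwb hwc hwd hwe).C_mul _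
  rw [twistedChart_X_of_ne k n a b c d e i hia hib hic hid hie]
  have h := isWeightedHomogeneous_X k w i
  rwa [hw0 i hia hib hic hid] at h

include hwa hwb hwc hwd hw0 in
/-- **T5-ii: the image of the universal twisted chart is `μ₃`-invariant** — `ψ₅(f)` is
`w`-homogeneous of weight `0` for every `f`. [OURS · L1 W4.5c] -/
theorem isWeightedHomogeneous_twistedChart (hab : a ≠ b) (hac : a ≠ c) (had : a ≠ d)
    (hae : a ≠ e) (hbc : b ≠ c) (hbd : b ≠ d) (hbe : b ≠ e) (hcd : c ≠ d) (hce : c ≠ e) (hde : d ≠ e)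
    (f : MvPolynomial (Fin n) k) : IsWeightedHomogeneous w (twistedChart k n a b c d e f) 0 := by
  induction f using MvPolynomial.induction_on with
  | C r => rw [twistedChart_C]; exact isWeightedHomogeneous_C w r
  | add p q hp hq => rw [map_add]; exact hp.add hq
  | mul_X p i hp =>
    rw [map_mul]
    have h := hp.mul (isWeightedHomogeneous_twistedChart_X k n a b c d e w hwa hwb hwc hwd hw0 hab
      hac had hae hbc hbd hbe hcd hce hde i)
    rwa [add_zero] at h

include hwa hwb hwc hwd hw0 in
/-- T5-ii, generator form: `ψ₅(f)` lies in the subalgebra generated by the `w`-weight-`0`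
monomials of `k[l, A, ξ, η₁, η₂, passengers]` (the `μ₃`-invariant Veronese subring).
[OURS · L1 W4.5c] -/
theorem twistedChart_mem_adjoin_monomial (hab : a ≠ b) (hac : a ≠ c) (had : a ≠ d)
    (hae : a ≠ e) (hbc : b ≠ c) (hbd : b ≠ d) (hbe : b ≠ e) (hcd : c ≠ d) (hce : c ≠ e) (hde : d ≠ e)
    (f : MvPolynomial (Fin n) k) :
    twistedChart k n a b c d e f ∈ Algebra.adjoin k {g : MvPolynomial (Fin n) k |
      ∃ m : Fin n →₀ ℕ, Finsupp.weight w m = 0 ∧ g = monomial m 1} :=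
  ToricExit.mem_adjoin_monomial_of_isWeightedHomogeneous_zero w _
    (isWeightedHomogeneous_twistedChart k n a b c d e w hwa hwb hwc hwd hw0 hab hac had hae hbc hbd
      hbe hcd hce hde f)

end DeckWeight

end Summit.ResolutionOfSingularities.ResolutionOfSingularities.Theorems.WildQuotientResolution.JordanFive

end
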